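import Mathlib

/-!
# Hodge locus census — the level lemma behind THEOREM T-0@3 (engine B, pub-hlocus abs-2 gen 26)

certified instances and evidence bearing on the general Hodge conjecture; no claim.

Engine B's derivation of abs-1's THEOREM T-0@3 (`v'(j(O_D)) = 3 (1 + v₃(b² + 3d²))` at the primes over 3,
`v₃(D) = 1`) reduces, after Gross's length formula, to a LEVEL LEMMA in the maximal order
`O = ℤ⟨1, i, ρ, iρ⟩`, `ρ = (1 + j)/2`, of the quaternion algebra `(-1,-3)_ℚ`: for `y = b i + c j + d k`,
`max over s t of v₃ (Nrd (y - s - t ρ)) = v₃ (b² + 3 d²)`.  Here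
`Nrd (y - s - tρ) = s² + s t + t² - 3 c t + (b² + 3c² + 3d²)` and
`4 · Nrd (y - s - tρ) = N (2s + t) (2c - t) + N (2b) (2d)` with the norm form `N x y = x² + 3y²` of `ℤ[√-3]`.
The arithmetic core is a NO-CANCELLATION statement for sums of two values of `N`
(`-1` is not a square mod 3): `3^k ∣ N x y + N z w → 3^k ∣ N x y`.  Everything is over `ℤ`
with an arbitrary exponent `k`, which is the form the 3-adic statement is used in.
-/

namespace Summit.HodgeConjecture.HodgeConjecture.HodgeLocus.Census.T03LevelLemma

/-- In `ZMod 3` a sum of two squares vanishes only if both do (`-1` is a non-square mod 3). -/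
theorem sq_add_sq_eq_zero_zmod3 : ∀ a b : ZMod 3, a ^ 2 + b ^ 2 = 0 → a = 0 ∧ b = 0 := by decide

/-- If `3 ∣ (x² + 3y²) + (z² + 3w²)` then `3 ∣ x` and `3 ∣ z`. -/
theorem three_dvd_of_dvd_norm_sum {x y z w : ℤ}
    (h : (3 : ℤ) ∣ (x ^ 2 + 3 * y ^ 2) + (z ^ 2 + 3 * w ^ 2)) : (3 : ℤ) ∣ x ∧ (3 : ℤ) ∣ z := by
  have hc : ((x ^ 2 + 3 * y ^ 2 + (z ^ 2 + 3 * w ^ 2) : ℤ) : ZMod 3) = 0 :=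
    (ZMod.intCast_zmod_eq_zero_iff_dvd _ 3).mpr h
  have h3 : (3 : ZMod 3) = 0 := by decide
  have h' : ((x : ZMod 3)) ^ 2 + ((z : ZMod 3)) ^ 2 = 0 := by
    have := hc
    push_cast at this
    rw [h3] at this
    linear_combination this
  obtain ⟨hx, hz⟩ := sq_add_sq_eq_zero_zmod3 _ _ h'
  exact ⟨(ZMod.intCast_zmod_eq_zero_iff_dvd x 3).mp hx, (ZMod.intCast_zmod_eq_zero_iff_dvd z 3).mp hz⟩

/-- NO CANCELLATION: a power of 3 dividing a sum of two norms `x² + 3y²`, `z² + 3w²` divides each of them. -/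
theorem pow_dvd_norm_of_dvd_sum : ∀ (k : ℕ) (x y z w : ℤ),
    (3 : ℤ) ^ k ∣ (x ^ 2 + 3 * y ^ 2) + (z ^ 2 + 3 * w ^ 2) → (3 : ℤ) ^ k ∣ x ^ 2 + 3 * y ^ 2
  | 0, _, _, _, _, _ => by simp
  | k + 1, x, y, z, w, h => by
      have h3 : (3 : ℤ) ∣ (x ^ 2 + 3 * y ^ 2) + (z ^ 2 + 3 * w ^ 2) :=
        dvd_trans (dvd_pow_self 3 (Nat.succ_ne_zero k)) h
      obtain ⟨⟨x', hx⟩, ⟨z', hz⟩⟩ := three_dvd_of_dvd_norm_sum h3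
      subst hx; subst hz
      have e : (3 * x') ^ 2 + 3 * y ^ 2 + ((3 * z') ^ 2 + 3 * w ^ 2)
          = 3 * ((y ^ 2 + 3 * x' ^ 2) + (w ^ 2 + 3 * z' ^ 2)) := by ring
      rw [e, pow_succ'] at h
      have h' : (3 : ℤ) ^ k ∣ (y ^ 2 + 3 * x' ^ 2) + (w ^ 2 + 3 * z' ^ 2) :=
        (mul_dvd_mul_iff_left (by norm_num : (3 : ℤ) ≠ 0)).mp h
      have ih := pow_dvd_norm_of_dvd_sum k y x' w z' h'
      have e2 : (3 * x') ^ 2 + 3 * y ^ 2 = 3 * (y ^ 2 + 3 * x' ^ 2) := by ring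
      rw [e2, pow_succ']
      exact mul_dvd_mul_left 3 ih

/-- Symmetric packaging: `3^k ∣ N₁ + N₂ ↔ 3^k ∣ N₁ ∧ 3^k ∣ N₂` for two norms from `ℤ[√-3]`
(i.e. `v₃ (N₁ + N₂) = min (v₃ N₁) (v₃ N₂)`). -/
theorem pow_dvd_norm_sum_iff (k : ℕ) (x y z w : ℤ) :
    (3 : ℤ) ^ k ∣ (x ^ 2 + 3 * y ^ 2) + (z ^ 2 + 3 * w ^ 2)
      ↔ (3 : ℤ) ^ k ∣ x ^ 2 + 3 * y ^ 2 ∧ (3 : ℤ) ^ k ∣ z ^ 2 + 3 * w ^ 2 := by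
  constructor
  · intro h
    refine ⟨pow_dvd_norm_of_dvd_sum k x y z w h, ?_⟩
    have h' : (3 : ℤ) ^ k ∣ (z ^ 2 + 3 * w ^ 2) + (x ^ 2 + 3 * y ^ 2) := by rwa [add_comm] at h
    exact pow_dvd_norm_of_dvd_sum k z w x y h'
  · rintro ⟨h1, h2⟩
    exact dvd_add h1 h2

/-- The reduced norm of `y - s - tρ` for `y = b i + c j + d k` in `(-1,-3)_ℚ`, `ρ = (1+j)/2`
(an integer-valued binary polynomial in `s t`; see the module docstring). -/
def levelPoly (b c d s t : ℤ) : ℤ := s ^ 2 + s * t + t ^ 2 - 3 * c * t + (b ^ 2 + 3 * c ^ 2 + 3 * d ^ 2)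

/-- `4 · Nrd (y - s - tρ)` splits as a sum of two norms from `ℤ[√-3]`. -/
theorem four_mul_levelPoly (b c d s t : ℤ) :
    4 * levelPoly b c d s t = ((2 * s + t) ^ 2 + 3 * (2 * c - t) ^ 2) + ((2 * b) ^ 2 + 3 * (2 * d) ^ 2) := by
  unfold levelPoly; ring

/-- The value at `z = c j`, i.e. `(s, t) = (-c, 2c)`, is exactly `b² + 3d²` (so the level is attained). -/
theorem levelPoly_at_cj (b c d : ℤ) : levelPoly b c d (-c) (2 * c) = b ^ 2 + 3 * d ^ 2 := by
  unfold levelPoly; ring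

/-- LEVEL LEMMA, upper bound: for all `s t`, every power of 3 dividing `Nrd (y - s - tρ)` divides `b² + 3d²`. -/
theorem level_le (b c d s t : ℤ) (k : ℕ) (h : (3 : ℤ) ^ k ∣ levelPoly b c d s t) :
    (3 : ℤ) ^ k ∣ b ^ 2 + 3 * d ^ 2 := by
  have h4 : (3 : ℤ) ^ k ∣ 4 * levelPoly b c d s t := dvd_mul_of_dvd_right h 4
  rw [four_mul_levelPoly] at h4
  have h5 : (3 : ℤ) ^ k ∣ (2 * b) ^ 2 + 3 * (2 * d) ^ 2 := by
    have := (pow_dvd_norm_sum_iff k (2 * s + t) (2 * c - t) (2 * b) (2 * d)).mp h4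
    exact this.2
  have e : (2 * b) ^ 2 + 3 * (2 * d) ^ 2 = 4 * (b ^ 2 + 3 * d ^ 2) := by ring
  rw [e] at h5
  have hcop : IsCoprime ((3 : ℤ) ^ k) 4 := by
    have h34 : IsCoprime (3 : ℤ) 4 := by
      rw [Int.isCoprime_iff_gcd_eq_one]; decide
    exact h34.pow_left
  exact hcop.dvd_of_dvd_mul_left h5

/-- LEVEL LEMMA (T-0@3, engine B): `3^k` divides `Nrd (y - s - tρ)` for SOME integers `s t`
iff `3^k ∣ b² + 3d²`; i.e. `max_{s,t} v₃ (Nrd (y - s - tρ)) = v₃ (b² + 3d²)`. -/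
theorem level_lemma (b c d : ℤ) (k : ℕ) :
    (∃ s t : ℤ, (3 : ℤ) ^ k ∣ levelPoly b c d s t) ↔ (3 : ℤ) ^ k ∣ b ^ 2 + 3 * d ^ 2 := by
  constructor
  · rintro ⟨s, t, h⟩; exact level_le b c d s t k h
  · intro h; exact ⟨-c, 2 * c, by rwa [levelPoly_at_cj]⟩

/-- Sanity instance (D = -84, class y = (3, 4, 3): b² + 3d² = 36, level 2, v' = 9; census: H₋₈₄ has two
roots of 3-adic valuation 9/2): `9 ∣ levelPoly 3 4 3 s t` is solvable and `27 ∣ _` is not. -/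
example : (∃ s t : ℤ, (3 : ℤ) ^ 2 ∣ levelPoly 3 4 3 s t) ∧ ¬ (∃ s t : ℤ, (3 : ℤ) ^ 3 ∣ levelPoly 3 4 3 s t) := by
  refine ⟨(level_lemma 3 4 3 2).mpr (by decide), fun h => ?_⟩
  have := (level_lemma 3 4 3 3).mp h
  revert this; decide

end Summit.HodgeConjecture.HodgeConjecture.HodgeLocus.Census.T03LevelLemma
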